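import Literature.NumberTheory.Sieve.PolymathGEHPiecesUniform
import Literature.NumberTheory.Sieve.PolymathGEHTypeII
import HarnessLib

/-!
# Prime-indicator pieces for `GEH[ϑ]` — the Siegel–Walfisz hypothesis by partial summation

Trunk AntSieve, tooling toward the named fact `Literature.NumberTheory.Sieve.weakDHL_three_two_of_GEH`
(D. H. J. Polymath, Res. Math. Sci. 1:12 (2014) = arXiv:1407.4897, Theorem 3.2(xii)).  In the proof of
Theorem 3.6(ii) (§4.5, p. 17) Claim 2.6 is applied with `β = 1_{A_j}`, the indicator of the PRIMES in a
short interval ("assigning `A_{j_r}` to be `β` … the claim now follows from the hypothesis `GEH[ϑ]`,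
thanks to the Siegel–Walfisz theorem").  This file verifies hypothesis (2.4) of Claim 2.6 for
`β = 1_{primes in (m, m']}` (`primePiece m m'`), uniformly in the scales as in
`vonMangoldtPiece_siegelWalfisz_uniform`, from which it is deduced: `1_P(n) = Λ(n) 1_P(n) / log n`,
the prime powers cost `ψ − θ ≤ 2 √y log y` (Mathlib's `Chebyshev.abs_psi_sub_theta_le_sqrt_mul_log`),
and the weight `1/log n` is removed by Abel summation over `n ∈ (m, m']` against the (uniformly bounded)
discrepancies of the pieces `Λ 1_P 1_{(m, y]}`, `m ≤ y ≤ m'`.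

## References

* [Polymath8b2014] D. H. J. Polymath, Res. Math. Sci. 1 (2014), Art. 12 = arXiv:1407.4897,
  Claim 2.6 (2.4) (p. 6), §4.5 (p. 17).
-/

noncomputable section

open Finset Real Filter
open scoped ArithmeticFunction.vonMangoldt ArithmeticFunction.sigma

namespace Literature.NumberTheory.Sieve

/-! ### The pieces -/

/-- `1_{primes in (m, m']}` as a real arithmetic function (the `β = 1_{A_j}` of §4.5).
[cite: Polymath8b2014, §4.5, p. 17] -/
def primePiece (m m' : ℕ) : ArithmeticFunction ℝ :=
  ⟨fun n => if m < n ∧ n ≤ m' ∧ n.Prime then 1 else 0, by simp [Nat.not_prime_zero]⟩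

/-- Values of the prime piece. [folklore] -/
theorem primePiece_apply (m m' n : ℕ) :
    primePiece m m' n = if m < n ∧ n ≤ m' ∧ n.Prime then 1 else 0 := rfl

/-- `Λ 1_P 1_{(m, y]}`: the von Mangoldt piece restricted to primes. [folklore] -/
def thetaPiece (m y : ℕ) : ℕ → ℝ := fun n => if m < n ∧ n ≤ y ∧ n.Prime then (Λ n : ℝ) else 0

/-- `1_P(n) 1_{(m,m']}(n) = (Λ 1_P 1_{(m,m']})(n) / log n`. [folklore] -/
theorem primePiece_eq_thetaPiece_div_log (m m' n : ℕ) :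
    (primePiece m m' n : ℝ) = thetaPiece m m' n * (1 / Real.log n) := by
  rw [primePiece_apply, thetaPiece]
  split_ifs with h
  · rw [ArithmeticFunction.vonMangoldt_apply_prime h.2.2]
    have : (1 : ℝ) < n := by exact_mod_cast h.2.2.one_lt
    have hlog : Real.log n ≠ 0 := (Real.log_pos this).ne'
    field_simp
  · simp

/-! ### Abel summation against single-point discrepancies -/

/-- Discrete Abel summation on `(m, m']`: for `T m = 0`,
`Σ_{y ∈ (m, m']} w(y) (T y − T (y−1)) = w(m') T(m') + Σ_{y ∈ [m+1, m')} (w y − w (y+1)) T y`. [folklore] -/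
theorem abel_Ioc (w T : ℕ → ℝ) (m : ℕ) : ∀ m' : ℕ, m ≤ m' → T m = 0 →
    ∑ y ∈ Ioc m m', w y * (T y - T (y - 1)) =
      w m' * T m' + ∑ y ∈ Ico (m + 1) m', (w y - w (y + 1)) * T y := by
  intro m' hmm' hT
  induction m' with
  | zero =>
    have : m = 0 := by omega
    subst this
    simp [hT]
  | succ m' ih =>
    rcases Nat.eq_or_lt_of_le hmm' with h | h
    · subst h
      simp [hT]
    · have hle : m ≤ m' := Nat.lt_succ_iff.1 h
      rw [Finset.sum_Ioc_succ_top (by omega), ih hle, Nat.succ_sub_one]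
      rcases Nat.eq_or_lt_of_le hle with h' | h'
      · subst h'
        simp [hT]
      · rw [Finset.sum_Ico_succ_top (by omega)]
        ring

/-! ### The discrepancy of the prime piece through those of the `θ`-pieces -/

/-- The `r`-coprime prime-supported `Λ`: `c(n) = Λ(n) 1_P(n) 1_{(n,r)=1}`. [folklore] -/
private def cθ (r n : ℕ) : ℝ := if n.Coprime r ∧ n.Prime then (Λ n : ℝ) else 0

/-- The coprime-filtered `θ`-piece through `cθ`. [folklore] -/
private theorem thetaPiece_coprime_eq (m r y n : ℕ) :
    (if n.Coprime r then thetaPiece m y n else 0) = if m < n ∧ n ≤ y then cθ r n else 0 := by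
  simp only [thetaPiece, cθ]
  by_cases hc : n.Coprime r <;> by_cases hp : n.Prime <;> by_cases hr : m < n ∧ n ≤ y <;>
    simp [hc, hp, hr]

/-- The discrepancy of the `θ`-piece `(m, y]` (with the coprimality filter), as a function of `y`. [folklore] -/
private def Dθ (m r N q : ℕ) (a : (ZMod q)ˣ) (y : ℕ) : ℝ :=
  apDiscrepancy (fun n => if n.Coprime r then thetaPiece m y n else 0) N q a

/-- `Dθ` through `cθ`. [folklore] -/
private theorem Dθ_eq (m r N q : ℕ) (a : (ZMod q)ˣ) (y : ℕ) :
    Dθ m r N q a y = apDiscrepancy (fun n => if m < n ∧ n ≤ y then cθ r n else 0) N q a :=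
  apDiscrepancy_congr (fun n _ => thetaPiece_coprime_eq m r y n) q a

/-- `Dθ(m) = 0` (empty piece). [folklore] -/
private theorem Dθ_self (m r N q : ℕ) (a : (ZMod q)ˣ) : Dθ m r N q a m = 0 := by
  rw [Dθ_eq, apDiscrepancy_congr (γ₂ := fun _ => (0 : ℝ)) (fun n _ => ?_), apDiscrepancy_zero]
  rw [if_neg]; omega

/-- Single-point increments: `Dθ(y) − Dθ(y−1)` is the discrepancy of the sequence supported at `y`. [folklore] -/
private theorem Dθ_sub (m r N q : ℕ) (a : (ZMod q)ˣ) {y : ℕ} (hy : m < y) :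
    Dθ m r N q a y - Dθ m r N q a (y - 1) = apDiscrepancy (fun n => if n = y then cθ r n else 0) N q a := by
  rw [Dθ_eq, Dθ_eq, ← apDiscrepancy_sub]
  refine apDiscrepancy_congr (fun n _ => ?_) q a
  by_cases hn : n = y
  · subst hn
    rw [if_pos ⟨hy, le_rfl⟩, if_neg (by omega), if_pos rfl, sub_zero]
  · rw [if_neg hn]
    by_cases h1 : m < n ∧ n ≤ y
    · rw [if_pos h1, if_pos ⟨h1.1, by omega⟩, sub_self]
    · rw [if_neg h1, if_neg (fun h => h1 ⟨h.1, by omega⟩), sub_self]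

/-- **The prime piece through the `θ`-pieces** (Abel summation):
`Δ(1_P 1_{(m,m']} 1_{(·,r)=1}) = w(m') Dθ(m') + Σ_{y ∈ [m+1, m')} (w(y) − w(y+1)) Dθ(y)`, `w = 1/log`.
[folklore] -/
private theorem apDiscrepancy_primePiece_eq (m m' r N q : ℕ) (a : (ZMod q)ˣ) (hmm' : m ≤ m') :
    apDiscrepancy (fun n => if n.Coprime r then primePiece m m' n else 0) N q a =
      (1 / Real.log m') * Dθ m r N q a m' +
        ∑ y ∈ Ico (m + 1) m', (1 / Real.log y - 1 / Real.log (y + 1 : ℕ)) * Dθ m r N q a y := by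
  -- decompose the piece into single points `y ∈ (m, m']`, each weighted by `1/log y`
  have hdec : ∀ n, (if n.Coprime r then (primePiece m m' n : ℝ) else 0) =
      ∑ y ∈ Ioc m m', (1 / Real.log y) * (if n = y then cθ r n else 0) := by
    intro n
    have hval : (if n.Coprime r then (primePiece m m' n : ℝ) else 0) =
        if m < n ∧ n ≤ m' then (1 / Real.log n) * cθ r n else 0 := by
      rw [primePiece_eq_thetaPiece_div_log]
      have := thetaPiece_coprime_eq m r m' n
      by_cases hc : n.Coprime r
      · rw [if_pos hc] at this ⊢
        rw [this]
        split_ifs <;> ring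
      · rw [if_neg hc] at this ⊢
        by_cases h1 : m < n ∧ n ≤ m'
        · rw [if_pos h1] at this ⊢
          rw [← this]; ring
        · rw [if_neg h1]
    rw [hval]
    by_cases hn : m < n ∧ n ≤ m'
    · rw [if_pos hn, Finset.sum_eq_single_of_mem n (Finset.mem_Ioc.2 hn)
        (fun y _ hyn => by rw [if_neg (Ne.symm hyn), mul_zero]), if_pos rfl]
    · rw [if_neg hn]
      refine (Finset.sum_eq_zero fun y hy => ?_).symm
      rw [if_neg, mul_zero]
      rintro rfl
      exact hn (Finset.mem_Ioc.1 hy)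
  rw [apDiscrepancy_congr (fun n _ => hdec n), apDiscrepancy_sum]
  simp only [apDiscrepancy_smul]
  have hterm : ∀ y ∈ Ioc m m', (1 / Real.log y) * apDiscrepancy (fun n => if n = y then cθ r n else 0) N q a =
      (1 / Real.log y) * (Dθ m r N q a y - Dθ m r N q a (y - 1)) := by
    intro y hy
    rw [Finset.mem_Ioc] at hy
    rw [Dθ_sub m r N q a hy.1]
  rw [Finset.sum_congr rfl hterm,
    abel_Ioc (fun y => 1 / Real.log y) (Dθ m r N q a) m m' hmm' (Dθ_self m r N q a)]

/-! ### Bounds -/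

/-- A crude bound: for a nonnegative sequence, `|Δ(d; N; a (q))| ≤ 2 Σ_{n ≤ N} d(n)` (`q ≥ 1`). [folklore] -/
theorem abs_apDiscrepancy_le_two_mul_sum {d : ℕ → ℝ} (hd : ∀ n, 0 ≤ d n) (N : ℕ) {q : ℕ} (hq : 1 ≤ q)
    (a : (ZMod q)ˣ) : |apDiscrepancy d N q a| ≤ 2 * ∑ n ∈ Icc 1 N, d n := by
  have hφ1 : (1 : ℝ) ≤ Nat.totient q := by exact_mod_cast Nat.totient_pos.2 (by omega)
  have hφ0 : (0 : ℝ) < Nat.totient q := by linarith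
  unfold apDiscrepancy
  set S := ∑ n ∈ Icc 1 N, d n
  have h1 : ∑ n ∈ (Icc 1 N).filter (fun n : ℕ => (n : ZMod q) = a), d n ≤ S :=
    Finset.sum_le_sum_of_subset_of_nonneg (Finset.filter_subset _ _) fun n _ _ => hd n
  have h2 : ∑ n ∈ (Icc 1 N).filter (fun n : ℕ => n.Coprime q), d n ≤ S :=
    Finset.sum_le_sum_of_subset_of_nonneg (Finset.filter_subset _ _) fun n _ _ => hd n
  have h1' : 0 ≤ ∑ n ∈ (Icc 1 N).filter (fun n : ℕ => (n : ZMod q) = a), d n := Finset.sum_nonneg fun n _ => hd n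
  have h2' : 0 ≤ ∑ n ∈ (Icc 1 N).filter (fun n : ℕ => n.Coprime q), d n := Finset.sum_nonneg fun n _ => hd n
  have h3 : (∑ n ∈ (Icc 1 N).filter (fun n : ℕ => n.Coprime q), d n) / Nat.totient q ≤ S :=
    (div_le_self h2' hφ1).trans h2
  have h3' : 0 ≤ (∑ n ∈ (Icc 1 N).filter (fun n : ℕ => n.Coprime q), d n) / Nat.totient q := div_nonneg h2' hφ0.le
  rw [abs_le]; constructor <;> linarith

/-- The prime powers: `ψ(y) − θ(y) = Σ_{n ≤ y, n not prime} Λ(n)`. [folklore] -/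
theorem psi_sub_theta_eq_sum (y : ℕ) :
    Chebyshev.psi y - Chebyshev.theta y = ∑ n ∈ (Ioc 0 y).filter (fun n => ¬ n.Prime), (Λ n : ℝ) := by
  rw [Chebyshev.psi, Chebyshev.theta, Nat.floor_natCast]
  have hθ : ∑ p ∈ (Ioc 0 y).filter Nat.Prime, Real.log p = ∑ n ∈ (Ioc 0 y).filter Nat.Prime, (Λ n : ℝ) :=
    Finset.sum_congr rfl fun p hp => (ArithmeticFunction.vonMangoldt_apply_prime (Finset.mem_filter.1 hp).2).symm
  rw [hθ, ← Finset.sum_filter_add_sum_filter_not (Ioc 0 y) Nat.Prime]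
  ring

/-- `|Dθ(y) − DΛ(y)| ≤ 2 (ψ(m') − θ(m'))` for `y ≤ m'`: the two pieces differ by the prime powers. [folklore] -/
private theorem abs_Dθ_sub_DΛ_le (m r N : ℕ) {q : ℕ} (hq : 1 ≤ q) (a : (ZMod q)ˣ) {y m' : ℕ} (hy : y ≤ m') :
    |Dθ m r N q a y - apDiscrepancy (fun n => if n.Coprime r then vonMangoldtPiece m y n else 0) N q a| ≤
      2 * (Chebyshev.psi m' - Chebyshev.theta m') := by
  unfold Dθ
  rw [← apDiscrepancy_sub, ← abs_neg, ← apDiscrepancy_neg]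
  -- the difference sequence `d(n) = 1_{(n,r)=1} 1_{(m,y]}(n) 1_{n not prime} Λ(n) ≥ 0`
  set d : ℕ → ℝ := fun n => -((if n.Coprime r then thetaPiece m y n else 0) -
      (if n.Coprime r then vonMangoldtPiece m y n else 0)) with hd
  have hdval : ∀ n, d n = if n.Coprime r ∧ m < n ∧ n ≤ y ∧ ¬ n.Prime then (Λ n : ℝ) else 0 := by
    intro n
    simp only [hd, thetaPiece, vonMangoldtPiece_apply]
    by_cases hc : n.Coprime r <;> by_cases h1 : m < n ∧ n ≤ y <;> by_cases hp : n.Prime <;>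
      simp [hc, h1, hp]
  have hd0 : ∀ n, 0 ≤ d n := fun n => by
    rw [hdval]; split_ifs
    · exact ArithmeticFunction.vonMangoldt_nonneg
    · exact le_rfl
  refine (abs_apDiscrepancy_le_two_mul_sum hd0 N hq a).trans ?_
  refine mul_le_mul_of_nonneg_left ?_ (by norm_num)
  rw [psi_sub_theta_eq_sum]
  -- `Σ_{n ≤ N} d(n) ≤ Σ_{n ≤ m', n not prime} Λ(n)`
  calc ∑ n ∈ Icc 1 N, d n = ∑ n ∈ (Icc 1 N).filter (fun n => n.Coprime r ∧ m < n ∧ n ≤ y ∧ ¬ n.Prime), (Λ n : ℝ) := by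
        rw [Finset.sum_filter]; exact Finset.sum_congr rfl fun n _ => hdval n
    _ ≤ ∑ n ∈ (Ioc 0 m').filter (fun n => ¬ n.Prime), (Λ n : ℝ) := by
        refine Finset.sum_le_sum_of_subset_of_nonneg ?_ fun _ _ _ => ArithmeticFunction.vonMangoldt_nonneg
        intro n hn
        simp only [Finset.mem_filter, Finset.mem_Icc, Finset.mem_Ioc] at hn ⊢
        exact ⟨⟨by omega, by omega⟩, hn.2.2.2.2⟩

/-- `1/log` is antitone on `[2, ∞)`. [folklore] -/
theorem one_div_log_antitone {y z : ℕ} (hy : 2 ≤ y) (hyz : y ≤ z) : 1 / Real.log z ≤ 1 / Real.log y := by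
  have hy1 : (1 : ℝ) < y := by exact_mod_cast hy
  exact one_div_le_one_div_of_le (Real.log_pos hy1) (Real.log_le_log (by linarith) (by exact_mod_cast hyz))

/-- Telescoping of the Abel weights: for `m + 1 ≤ m'`,
`w(m') + Σ_{y ∈ [m+1, m')} (w y − w (y+1)) = w(m+1)`. [folklore] -/
theorem abel_weights_telescope (w : ℕ → ℝ) (m : ℕ) : ∀ m' : ℕ, m + 1 ≤ m' →
    w m' + ∑ y ∈ Ico (m + 1) m', (w y - w (y + 1)) = w (m + 1) := by
  intro m' hm'
  induction m' with
  | zero => omega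
  | succ m' ih =>
    rcases Nat.eq_or_lt_of_le hm' with h | h
    · rw [← h]; simp
    · rw [Finset.sum_Ico_succ_top (by omega), ← ih (by omega)]; ring

set_option maxHeartbeats 800000 in
-- explicit-constant estimate with a dozen auxiliary inequalities
/-- **Claim 2.6 (2.4) for `β = 1_{primes in (m, m']}`, uniformly in the scales**: for every `B > 0`
there is `C` with, eventually in `x`, for all natural `x^{c₀} ≤ m ≤ m' ≤ K m`, `m' ≤ x`, all `q, r ≥ 1`
and primitive `a (q)`:
`|Δ(1_P 1_{(m,m']} 1_{(·,r)=1}; a (q))| ≤ C τ(qr)^k m (log x)^{-B}` (cut-off `⌊K m⌋`, `k ≥ 1`).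
[cite: Polymath8b2014, Claim 2.6 (2.4) and §4.5, p. 17] -/
theorem primePiece_siegelWalfisz_uniform {c₀ : ℝ} (hc₀ : 0 < c₀) (K : ℝ) (hK : 1 ≤ K)
    (k : ℕ) (hk : 1 ≤ k) (B : ℝ) (hB : 0 < B) :
    ∃ C : ℝ, ∀ᶠ x : ℝ in atTop, ∀ m m' : ℕ, x ^ c₀ ≤ (m : ℝ) → m ≤ m' → (m' : ℝ) ≤ K * m → (m' : ℝ) ≤ x →
      ∀ q r : ℕ, 1 ≤ q → 1 ≤ r → ∀ a : (ZMod q)ˣ,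
      |apDiscrepancy (fun n => if n.Coprime r then primePiece m m' n else 0) ⌊K * (m : ℝ)⌋₊ q a|
        ≤ C * (σ 0 (q * r) : ℝ) ^ k * m / Real.log x ^ B := by
  obtain ⟨CΛ, hCΛ⟩ := vonMangoldtPiece_siegelWalfisz_uniform hc₀ K hK k hk B hB
  refine ⟨2 * (max CΛ 0 + 4), ?_⟩
  -- eventually `K (log x)^{2B+2} ≤ x^{c₀}` (for the prime powers) and `x^{c₀} ≥ 4`
  have e1 : ∀ᶠ x : ℝ in atTop, Real.sqrt K * Real.log x ^ (B + 1) ≤ Real.sqrt (x ^ c₀) := by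
    have h := (isLittleO_log_rpow_rpow_atTop (B + 1) (by positivity : 0 < c₀ / 2)).bound
      (show 0 < 1 / Real.sqrt K by positivity)
    filter_upwards [h, eventually_ge_atTop (1 : ℝ)] with x hx hx1
    have hx0 : 0 < x := by linarith
    rw [Real.norm_of_nonneg (Real.rpow_nonneg (Real.log_nonneg hx1) _),
      Real.norm_of_nonneg (Real.rpow_nonneg hx0.le _)] at hx
    have hK0 : 0 < Real.sqrt K := Real.sqrt_pos.2 (by linarith)
    have hs : Real.sqrt (x ^ c₀) = x ^ (c₀ / 2) := by
      rw [Real.sqrt_eq_rpow, ← Real.rpow_mul hx0.le]; ring_nf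
    rw [hs]
    calc Real.sqrt K * Real.log x ^ (B + 1) ≤ Real.sqrt K * (1 / Real.sqrt K * x ^ (c₀ / 2)) :=
          mul_le_mul_of_nonneg_left hx hK0.le
      _ = x ^ (c₀ / 2) := by field_simp
  have e2 : ∀ᶠ x : ℝ in atTop, (4 : ℝ) ≤ x ^ c₀ := (tendsto_rpow_atTop hc₀).eventually_ge_atTop _
  have e3 : ∀ᶠ x : ℝ in atTop, Real.exp 1 ≤ x := eventually_ge_atTop _
  filter_upwards [hCΛ, e1, e2, e3] with x hxΛ hx1 hx2 hx3 m m' hm hmm' hm'K hm'x q r hq hr a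
  have hx0 : 0 < x := lt_of_lt_of_le (Real.exp_pos 1) hx3
  have hlogx : 1 ≤ Real.log x := by rwa [Real.le_log_iff_exp_le hx0]
  have hlogx0 : 0 < Real.log x := by linarith
  have hm4 : (4 : ℝ) ≤ m := hx2.trans hm
  have hm2 : 2 ≤ m := by exact_mod_cast (show (2 : ℝ) ≤ m by linarith)
  have hmpos : (0 : ℝ) < m := by linarith
  have hK0 : (0 : ℝ) ≤ K := by linarith
  -- the uniform bound `E` for the `θ`-pieces `(m, y]`, `m ≤ y ≤ m'`
  set X : ℝ := (σ 0 (q * r) : ℝ) ^ k * m / Real.log x ^ B with hX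
  have hτ1 : (1 : ℝ) ≤ (σ 0 (q * r) : ℝ) ^ k := by
    have : 1 ≤ σ 0 (q * r) := by
      rw [ArithmeticFunction.sigma_zero_apply]
      exact Finset.card_pos.2 ⟨1, Nat.one_mem_divisors.2 (Nat.mul_ne_zero (by omega) (by omega))⟩
    exact one_le_pow₀ (by exact_mod_cast this)
  have hX0 : 0 ≤ X := by rw [hX]; positivity
  have hmX : (m : ℝ) / Real.log x ^ B ≤ X := by
    rw [hX, mul_div_assoc]; exact le_mul_of_one_le_left (by positivity) hτ1
  -- prime powers: `2 (ψ(m') - θ(m')) ≤ 4 √(m') log m' ≤ 4 X`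
  have hpp : 2 * (Chebyshev.psi m' - Chebyshev.theta m') ≤ 4 * X := by
    have hm'1 : (1 : ℝ) ≤ m' := by
      have : (m : ℝ) ≤ m' := by exact_mod_cast hmm'
      linarith
    have h1 := Chebyshev.abs_psi_sub_theta_le_sqrt_mul_log hm'1
    have h2 : Chebyshev.psi m' - Chebyshev.theta m' ≤ 2 * Real.sqrt m' * Real.log m' := (le_abs_self _).trans h1
    -- `√m' log m' ≤ √(K m) log x ≤ m / log^B x`
    have h3 : Real.sqrt m' * Real.log m' ≤ Real.sqrt (K * m) * Real.log x :=
      mul_le_mul (Real.sqrt_le_sqrt hm'K) (Real.log_le_log (by linarith) hm'x)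
        (Real.log_nonneg hm'1) (Real.sqrt_nonneg _)
    have h4 : Real.sqrt (K * m) * Real.log x ≤ m / Real.log x ^ B := by
      -- from `√K log^{B+1} x ≤ √(x^{c₀}) ≤ √m`
      have h5 : Real.sqrt K * Real.log x ^ (B + 1) ≤ Real.sqrt m := hx1.trans (Real.sqrt_le_sqrt hm)
      rw [le_div_iff₀ (Real.rpow_pos_of_pos hlogx0 B), Real.sqrt_mul hK0]
      have e : Real.log x * Real.log x ^ B = Real.log x ^ (B + 1) := by
        rw [Real.rpow_add hlogx0, Real.rpow_one, mul_comm]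
      calc Real.sqrt K * Real.sqrt m * Real.log x * Real.log x ^ B
          = (Real.sqrt K * Real.log x ^ (B + 1)) * Real.sqrt m := by rw [mul_assoc, e]; ring
        _ ≤ Real.sqrt m * Real.sqrt m := mul_le_mul_of_nonneg_right h5 (Real.sqrt_nonneg _)
        _ = m := Real.mul_self_sqrt hmpos.le
    linarith [hmX]
  have hE : ∀ y : ℕ, m ≤ y → y ≤ m' → |Dθ m r ⌊K * (m : ℝ)⌋₊ q a y| ≤ (max CΛ 0 + 4) * X := by
    intro y hmy hym'
    have hyK : (y : ℝ) ≤ K * m := le_trans (by exact_mod_cast hym') hm'K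
    have hyx : (y : ℝ) ≤ x := le_trans (by exact_mod_cast hym') hm'x
    have h1 := hxΛ m y hm hmy hyK hyx q r hq hr a
    have h2 := abs_Dθ_sub_DΛ_le m r ⌊K * (m : ℝ)⌋₊ hq a hym'
    have h3 : CΛ * (σ 0 (q * r) : ℝ) ^ k * m / Real.log x ^ B ≤ max CΛ 0 * X := by
      rw [hX]
      calc CΛ * (σ 0 (q * r) : ℝ) ^ k * m / Real.log x ^ B = CΛ * ((σ 0 (q * r) : ℝ) ^ k * m / Real.log x ^ B) := by ring
        _ ≤ max CΛ 0 * ((σ 0 (q * r) : ℝ) ^ k * m / Real.log x ^ B) :=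
            mul_le_mul_of_nonneg_right (le_max_left _ _) (by positivity)
    have := abs_sub_abs_le_abs_sub (Dθ m r ⌊K * (m : ℝ)⌋₊ q a y)
      (apDiscrepancy (fun n => if n.Coprime r then vonMangoldtPiece m y n else 0) ⌊K * (m : ℝ)⌋₊ q a)
    have e : (max CΛ 0 + 4) * X = max CΛ 0 * X + 4 * X := by ring
    rw [e]
    linarith
  -- Abel summation
  rw [apDiscrepancy_primePiece_eq m m' r _ q a hmm']
  have hw0 : ∀ y : ℕ, 2 ≤ y → 0 ≤ 1 / Real.log y := fun y hy =>
    div_nonneg zero_le_one (Real.log_nonneg (by exact_mod_cast (show 1 ≤ y by omega)))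
  have hfirst : |(1 / Real.log m') * Dθ m r ⌊K * (m : ℝ)⌋₊ q a m'| ≤ (1 / Real.log m') * ((max CΛ 0 + 4) * X) := by
    rw [abs_mul, abs_of_nonneg (hw0 m' (hm2.trans hmm'))]
    exact mul_le_mul_of_nonneg_left (hE m' hmm' le_rfl) (hw0 m' (hm2.trans hmm'))
  have hrest : |∑ y ∈ Ico (m + 1) m', (1 / Real.log y - 1 / Real.log (y + 1 : ℕ)) * Dθ m r ⌊K * (m : ℝ)⌋₊ q a y| ≤
      ∑ y ∈ Ico (m + 1) m', (1 / Real.log y - 1 / Real.log (y + 1 : ℕ)) * ((max CΛ 0 + 4) * X) := by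
    refine (Finset.abs_sum_le_sum_abs _ _).trans (Finset.sum_le_sum fun y hy => ?_)
    rw [Finset.mem_Ico] at hy
    have hdiff : 0 ≤ 1 / Real.log y - 1 / Real.log (y + 1 : ℕ) :=
      sub_nonneg.2 (one_div_log_antitone (by omega) (Nat.le_succ y))
    rw [abs_mul, abs_of_nonneg hdiff]
    exact mul_le_mul_of_nonneg_left (hE y (by omega) (by omega)) hdiff
  -- telescoping: `w(m') + Σ (w y - w (y+1)) = w(m+1)` (or `w(m)` if the range is empty)
  have htel : (1 / Real.log m') + ∑ y ∈ Ico (m + 1) m', (1 / Real.log y - 1 / Real.log (y + 1 : ℕ)) ≤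
      1 / Real.log 2 := by
    rcases Nat.lt_or_ge m m' with hlt | hge
    · have := abel_weights_telescope (fun y => 1 / Real.log y) m m' hlt
      simp only [Nat.cast_succ] at this
      have e : ∀ y : ℕ, (1 / Real.log y - 1 / Real.log (y + 1 : ℕ)) = (1 / Real.log y - 1 / Real.log ((y : ℝ) + 1)) :=
        fun y => by push_cast; ring
      simp only [e]
      rw [this]
      have h2 : ((m + 1 : ℕ) : ℝ) = (m : ℝ) + 1 := by push_cast; ring
      rw [← h2]
      have h3 : 1 / Real.log ((m + 1 : ℕ) : ℝ) ≤ 1 / Real.log ((2 : ℕ) : ℝ) :=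
        one_div_log_antitone (y := 2) (z := m + 1) (le_refl 2) (by omega)
      rwa [Nat.cast_ofNat] at h3
    · have hm'm : m' = m := le_antisymm hge hmm'
      rw [hm'm, Finset.Ico_eq_empty (by omega), Finset.sum_empty, add_zero]
      have h3 : 1 / Real.log (m : ℝ) ≤ 1 / Real.log ((2 : ℕ) : ℝ) :=
        one_div_log_antitone (y := 2) (z := m) (le_refl 2) hm2
      rwa [Nat.cast_ofNat] at h3
  have hEX : 0 ≤ (max CΛ 0 + 4) * X := by positivity
  have hlog2 : 1 / Real.log 2 ≤ 2 := by
    rw [div_le_iff₀ (Real.log_pos (by norm_num))]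
    have := Real.log_two_gt_d9; linarith
  calc |1 / Real.log ↑m' * Dθ m r ⌊K * ↑m⌋₊ q a m' +
        ∑ y ∈ Ico (m + 1) m', (1 / Real.log ↑y - 1 / Real.log ↑(y + 1)) * Dθ m r ⌊K * ↑m⌋₊ q a y|
      ≤ (1 / Real.log m') * ((max CΛ 0 + 4) * X) +
          ∑ y ∈ Ico (m + 1) m', (1 / Real.log y - 1 / Real.log (y + 1 : ℕ)) * ((max CΛ 0 + 4) * X) :=
        (abs_add_le _ _).trans (add_le_add hfirst hrest)
    _ = ((1 / Real.log m') + ∑ y ∈ Ico (m + 1) m', (1 / Real.log y - 1 / Real.log (y + 1 : ℕ))) *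
          ((max CΛ 0 + 4) * X) := by rw [← Finset.sum_mul]; ring
    _ ≤ (1 / Real.log 2) * ((max CΛ 0 + 4) * X) := mul_le_mul_of_nonneg_right htel hEX
    _ ≤ 2 * ((max CΛ 0 + 4) * X) := mul_le_mul_of_nonneg_right hlog2 hEX
    _ = 2 * (max CΛ 0 + 4) * (σ 0 (q * r) : ℝ) ^ k * m / Real.log x ^ B := by rw [hX]; ring

end Literature.NumberTheory.Sieve
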